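import Summits.ValiantsHypothesis.ValiantsHypothesis.Theses.BarrierLever
import Summits.ValiantsHypothesis.ValiantsHypothesis.Theorems.BarrierLeverChowHitsThinRowPartitionMinorsRLeaveOut
import Summits.ValiantsHypothesis.ValiantsHypothesis.Theorems.BarrierLeverChowHitsThinRowPartitionMinorsRSlices
import Summits.ValiantsHypothesis.ValiantsHypothesis.Theorems.BarrierLeverChowHitsThinRowPartitionMinorsRBasisSingletons

/-!
# Route BarrierLever — item `ChowHitsThinRowPartitionMinorsR` (stmt-ValiantsHypothesis-21850, budget
# `h·h`): the by-name NODE «leave-out certificates exist on the residual» and its arrow to the item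

Node file (`--supports stmt-ValiantsHypothesis-21850`; cell valiant-natproofs, rung V4, 𝒟-side; seat
val-np-p5 gen 28; planner ruling R31, STATUS l.1667: registry v1 of line `antipodal_gadget` stands and
this node enters BY NAME).  Imports the route file and this seat's `…RLeaveOut`, `…RSlices`,
`…RBasisSingletons`.

* `Stmt.stub_leaveOut` (node text = Conjecture LO / AC′ of memo MEMO-21850-hh-valnp5-g28 §7–§8 on the
  residual): for every near-full thin layout (`#singles + h + 2·#pairs > h·h`, the budget of
  `chowHitsHH_of_card` fails) whose columns have a used coordinate that is NOT affinely free (the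
  hypothesis of `chowHitsHH_of_freeCoordinates` fails), there are `y`-parts `β` (one affine form per
  singleton row, one squared gadget part per pair row) and `np` public `y`-forms within the budget
  `#singles + np + 2·#pairs ≤ h·h` whose LEAVE-OUT MATRIX is nonsingular.  The explicit ABSORBED
  certificate (memo §7.1/§8; 0 dead in > 14 M layouts, h ≤ 10, and on all boundary families tested) is
  the candidate witness.
* `ChowHitsThinRowPartitionMinorsR_of_leaveOut : Stmt.stub_leaveOut → ChowHitsThinRowPartitionMinorsR`
  (by `chowHitsHH_of_card`, `chowHitsHH_of_freeCoordinates`, `chowHitsHH_of_leaveOut`).  Chain of record: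
  AC′ ⇒ `Stmt.stub_leaveOut` ⇒ item (⇒ the registered stubs `stub_fullPairs`, `stub_missingPairs`).

WHAT THIS IS NOT: item 21850 is NOT proved (`Stmt.stub_leaveOut` is open); nothing on items 21882 /
19717, on crux stmt-ValiantsHypothesis-14610, or on `VP` versus `VNP`.
-/

set_option linter.dupNamespace false

namespace Summit.ValiantsHypothesis.ValiantsHypothesis.Theorems.BarrierLever.ChowThinHH

open Finset MvPolynomial
open Summit.ValiantsHypothesis.ValiantsHypothesis.Theses.BarrierLever

/-- NODE (text, open).  Leave-out certificates exist on the residual: rows `u` injective of size `≤ 2`,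
columns `w` injective, `#singles + h + 2·#pairs > h·h` and some used coordinate is an affine combination
of `1` and the earlier coordinates on the column points ⇒ some `y`-design within budget has a
nonsingular leave-out matrix (the matrix of `chowHitsHH_of_leaveOut`). -/
def Stmt.stub_leaveOut : Prop :=
  ∃ h₀ : ℕ, ∀ h : ℕ, h₀ ≤ h → ∀ (r : ℕ) (u w : Fin r → Finset (Fin h)),
    Function.Injective u → Function.Injective w → (∀ i, (u i).card ≤ 2) →
    h * h < (Finset.univ.filter fun i : Fin r => (u i).card = 1).card + h +
      2 * (Finset.univ.filter fun i : Fin r => (u i).card = 2).card →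
    (∃ c ∈ Finset.univ.biUnion w,
      (fun j : Fin r => if c ∈ w j then (1 : ℂ) else 0) ∈ Submodule.span ℂ
        (insert (fun _ : Fin r => (1 : ℂ))
          ((fun c' : Fin h => fun j : Fin r => if c' ∈ w j then (1 : ℂ) else 0) '' {c' | c' < c}))) →
    ∃ (β : Fin r → Fin h → ℂ) (np : ℕ) (π : Fin np → Fin h → ℂ),
      (Finset.univ.filter fun i : Fin r => (u i).card = 1).card + np +
        2 * (Finset.univ.filter fun i : Fin r => (u i).card = 2).card ≤ h * h ∧
      (Matrix.of fun i j : Fin r =>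
        coeff (∑ a ∈ (∅ : Finset (Fin h)), Finsupp.single (Fin.castAdd h a) 1 +
            ∑ c ∈ w j, Finsupp.single (Fin.natAdd h c) 1)
          ((∏ i' ∈ (Finset.univ.filter fun i : Fin r => (u i).card = 1).erase i,
              (C 1 + ∑ c, C (β i' c) * X (Fin.natAdd h c) : MvPolynomial (Fin (h + h)) ℂ)) *
            (∏ p, (C 1 + ∑ c, C (π p c) * X (Fin.natAdd h c) : MvPolynomial (Fin (h + h)) ℂ)) *
            ∏ i' ∈ (Finset.univ.filter fun i : Fin r => (u i).card = 2).erase i,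
              (C 1 + ∑ c, C (β i' c) * X (Fin.natAdd h c) : MvPolynomial (Fin (h + h)) ℂ) ^ 2)).det ≠ 0

/-- **The node implies item 21850.**  The complementary ranges enter by name
(`chowHitsHH_of_card`, `chowHitsHH_of_freeCoordinates`); the node by `chowHitsHH_of_leaveOut`. -/
theorem ChowHitsThinRowPartitionMinorsR_of_leaveOut :
    Stmt.stub_leaveOut → ChowHitsThinRowPartitionMinorsR := by
  classical
  rintro ⟨h₀, H⟩
  refine ⟨h₀, fun h hh r u w hu hw hu2 => ?_⟩
  by_cases hb : (Finset.univ.filter fun i : Fin r => (u i).card = 1).card + h +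
      2 * (Finset.univ.filter fun i : Fin r => (u i).card = 2).card ≤ h * h
  · exact chowHitsHH_of_card h r u w hu hw hu2 hb
  by_cases hd : ∃ c ∈ Finset.univ.biUnion w,
      (fun j : Fin r => if c ∈ w j then (1 : ℂ) else 0) ∈ Submodule.span ℂ
        (insert (fun _ : Fin r => (1 : ℂ))
          ((fun c' : Fin h => fun j : Fin r => if c' ∈ w j then (1 : ℂ) else 0) '' {c' | c' < c}))
  · obtain ⟨β, np, π, hbud, hdet⟩ := H h hh r u w hu hw hu2 (Nat.lt_of_not_le hb) hd
    exact chowHitsHH_of_leaveOut h r u w hu hu2 β np π hbud hdet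
  · exact chowHitsHH_of_freeCoordinates h r u w hu hu2 hw (fun c hc hmem => hd ⟨c, hc, hmem⟩)

end Summit.ValiantsHypothesis.ValiantsHypothesis.Theorems.BarrierLever.ChowThinHH
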